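import Literature.AnabelianGeometry.EtaleTheta.ThetaRigiditySchemaWitness
import Mathlib.Tactic.LinearCombination
import HarnessLib

/-!
# [EtTh] Prop. 2.14 (iii), the cusp-label clause `RigidData.ActsOnCuspsBy` (FACT-LIST F-0619): INSTANCE FORMS
# (proof-only companion of `ThetaRigidity.lean`; 0 definitions)

S. Mochizuki, *The étale theta function and its Frobenioid-theoretic manifestations* [EtTh], Publ. RIMS **45**
(2009), §2, Prop. 2.14 (iii), PRIMS PDF pp. 49–50 [cite: MochizukiEtTh2009, Prop 2.14(iii) p.50]: «every
automorphism … induces an automorphism of `Π^tp_Y`, hence an automorphism of the set of cusps of `Y`. Relative to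
the labels `∈ ℤ` on these cusps, this automorphism … is of the form `n ↦ ε·n + a` for `(a, ε) ∈ (l·ℤ) ⋊ {±1}`».
The typer (abc-iut-L2-t2) records the bookkeeping as the PREDICATE `R.ActsOnCuspsBy a s ε :=
∀ n, (map a) '' R.cuspY n = R.cuspY (ε n + s)` over the interface `RigidData N l`; its universal closure over
`(R, a, s, ε)` is FALSE (`RigidData.Toy.not_forall_actsOnCuspsBy`, abc-iut-w5-d175) — as expected of a predicate
consumed BY NAME inside `Prop214_iii_mono` / `Prop214_iii_bi`.

Cell abc-iut, block F (FACT-LIST instance-form wave INST59, KEY INST59J1 row F-0619), seat abc-iut-f-108 (gen 4).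
WHAT THIS FILE RECORDS (pure group theory over the interface; nothing printed is asserted or denied):
* §1 `actsOnCuspsBy_refl` — **INSTANCE FORM, 0 hypotheses, at EVERY `R : RigidData N l`** (in particular at the
  genuine §1-born data `DoubleUnderline.rigidData` of `RigidOfSetting.lean`): the identity of `Π^tp_Y` acts on
  the cusp labels by `(a, ε) = (0, +1)`, the neutral element of `(l·ℤ) ⋊ {±1}`.
* §2 the `(l·ℤ) ⋊ {±1}`-LAWS of the predicate: `ActsOnCuspsBy.trans` (composition multiplies as in the
  semidirect product `ℤ ⋊ ℤˣ`: `(s, ε)·(t, δ) = (δ s + t, δ ε)`), `ActsOnCuspsBy.symm` (inverse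
  `(−ε⁻¹ s, ε⁻¹)`), `ActsOnCuspsBy.unique` (for INJECTIVE label maps the pair `(s, ε)` is determined by `a`)
  — so `{(s, ε) | ∃ a, R.ActsOnCuspsBy a s ε}` is a SUBGROUP of `ℤ ⋊ ℤˣ` containing `(0, 1)`, which is the shape
  print's «`Aut(M) → (l·ℤ) ⋊ {±1}`» presupposes.
* §3 at the TOY carrier `RigidData.Toy.toy l` (abc-iut-w5-d175; labels `{⊥}` at `0`, `∅` elsewhere — a designed
  toy, NOT the cusps of a curve): EVERY bi-continuous automorphism of `Π^tp_Y` acts by `(0, ε)` for BOTH signs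
  `ε = ±1` (`Toy.actsOnCuspsBy_zero`), and by no `(s, ε)` with `s ≠ 0` (`Toy.actsOnCuspsBy_iff`).
HONEST FRAMING: instance forms about OUR typed predicate; an instance at a carrier ≠ the printed proposition;
typed ≠ proved; no side is taken on [IUTchIII] Cor. 3.12 or on any author.
-/

namespace Literature.AnabelianGeometry.EtaleTheta

namespace RigidData

universe u

variable {N : ℕ+} {l : ℕ} (R : RigidData.{u} N l)

/-! ### §1 The identity acts by `(0, +1)` — at every `RigidData` -/

/-- **F-0619 INSTANCE FORM (0 hypotheses, every `R`)**: the identity automorphism of `Π^tp_Y` acts on the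
labelled cusps of `Y` by `n ↦ 1·n + 0`. [cite: MochizukiEtTh2009, Prop 2.14(iii) p.50] -/
theorem actsOnCuspsBy_refl :
    Literature.AnabelianGeometry.EtaleTheta.RigidData.ActsOnCuspsBy R (ContinuousMulEquiv.refl R.PiY) 0 1 := by
  intro n
  have h : (fun H : Subgroup R.PiY => H.map (ContinuousMulEquiv.refl R.PiY).toMulEquiv.toMonoidHom) = id := by
    funext H
    exact Subgroup.map_id H
  rw [h, Set.image_id, Units.val_one, one_mul, add_zero]

/-! ### §2 The semidirect-product laws `(l·ℤ) ⋊ {±1}` of the predicate -/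

variable {R}

/-- Transport of the label image along a composite: `map (a ≫ b) = map b ∘ map a` on subgroups.
[cite: MochizukiEtTh2009, Prop 2.14(iii) p.50] -/
theorem image_map_trans (a b : R.PiY ≃ₜ* R.PiY) (S : Set (Subgroup R.PiY)) :
    (fun H : Subgroup R.PiY => H.map (a.trans b).toMulEquiv.toMonoidHom) '' S =
      (fun H : Subgroup R.PiY => H.map b.toMulEquiv.toMonoidHom) ''
        ((fun H : Subgroup R.PiY => H.map a.toMulEquiv.toMonoidHom) '' S) := by
  rw [Set.image_image]
  refine Set.image_congr' fun H => ?_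
  rw [Subgroup.map_map]
  rfl

/-- **Composition law**: if `a` acts on the cusp labels by `(s, ε)` and `b` by `(t, δ)`, then `a` followed by `b`
acts by `(δ s + t, δ ε)` — the multiplication of `ℤ ⋊ ℤˣ`. [cite: MochizukiEtTh2009, Prop 2.14(iii) p.50] -/
theorem ActsOnCuspsBy.trans {a b : R.PiY ≃ₜ* R.PiY} {s t : ℤ} {ε δ : ℤˣ}
    (ha : R.ActsOnCuspsBy a s ε) (hb : R.ActsOnCuspsBy b t δ) :
    Literature.AnabelianGeometry.EtaleTheta.RigidData.ActsOnCuspsBy R (a.trans b) (δ * s + t) (δ * ε) := by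
  intro n
  rw [image_map_trans, ha n, hb (ε * n + s), Units.val_mul]
  ring_nf

/-- `map a.symm ∘ map a = id` on subgroups of `Π^tp_Y`. [cite: MochizukiEtTh2009, Prop 2.14(iii) p.50] -/
theorem image_map_symm_image_map (a : R.PiY ≃ₜ* R.PiY) (S : Set (Subgroup R.PiY)) :
    (fun H : Subgroup R.PiY => H.map a.symm.toMulEquiv.toMonoidHom) ''
        ((fun H : Subgroup R.PiY => H.map a.toMulEquiv.toMonoidHom) '' S) = S := by
  rw [← image_map_trans]
  have h : (fun H : Subgroup R.PiY => H.map (a.trans a.symm).toMulEquiv.toMonoidHom) = id := by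
    funext H
    have he : (a.trans a.symm).toMulEquiv.toMonoidHom = MonoidHom.id R.PiY :=
      MonoidHom.ext fun x => a.symm_apply_apply x
    rw [he]
    exact Subgroup.map_id H
  rw [h, Set.image_id]

/-- **Inverse law**: if `a` acts by `(s, ε)` then `a⁻¹` acts by `(−ε⁻¹ s, ε⁻¹)` — the inverse in `ℤ ⋊ ℤˣ`.
[cite: MochizukiEtTh2009, Prop 2.14(iii) p.50] -/
theorem ActsOnCuspsBy.symm {a : R.PiY ≃ₜ* R.PiY} {s : ℤ} {ε : ℤˣ} (ha : R.ActsOnCuspsBy a s ε) :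
    Literature.AnabelianGeometry.EtaleTheta.RigidData.ActsOnCuspsBy R a.symm (-((ε⁻¹ : ℤˣ) : ℤ) * s) ε⁻¹ := by
  intro m
  have key := ha ((ε⁻¹ : ℤˣ) * m + -((ε⁻¹ : ℤˣ) : ℤ) * s)
  have hlab : (ε : ℤ) * (((ε⁻¹ : ℤˣ) : ℤ) * m + -((ε⁻¹ : ℤˣ) : ℤ) * s) + s = m := by
    have hu : (ε : ℤ) * ((ε⁻¹ : ℤˣ) : ℤ) = 1 := by rw [← Units.val_mul, mul_inv_cancel, Units.val_one]
    linear_combination (m - s) * hu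
  rw [hlab] at key
  rw [← key, image_map_symm_image_map]

/-- **Uniqueness of the label action for injective labellings**: if `n ↦ R.cuspY n` is injective (distinct labels
name distinct sets of cuspidal decomposition groups, as for the cusps of `Y`, p. 42), then an automorphism acts on
the labels by AT MOST ONE `(s, ε)`. [cite: MochizukiEtTh2009, Prop 2.14(iii) p.50] -/
theorem ActsOnCuspsBy.unique (hinj : Function.Injective R.cuspY) {a : R.PiY ≃ₜ* R.PiY} {s s' : ℤ}
    {ε ε' : ℤˣ} (h : R.ActsOnCuspsBy a s ε) (h' : R.ActsOnCuspsBy a s' ε') : s = s' ∧ ε = ε' := by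
  have h0 : s = s' := by
    have := (h 0).symm.trans (h' 0)
    simpa using hinj this
  refine ⟨h0, Units.ext ?_⟩
  have h1 := hinj ((h 1).symm.trans (h' 1))
  rw [mul_one, mul_one, h0] at h1
  exact add_right_cancel h1

/-- The set of realised label actions contains the neutral element and is closed under the `ℤ ⋊ ℤˣ` laws
(summary of §1–§2). [cite: MochizukiEtTh2009, Prop 2.14(iii) p.50] -/
theorem actsOnCuspsBy_laws :
    R.ActsOnCuspsBy (ContinuousMulEquiv.refl R.PiY) 0 1 ∧
    (∀ {a b : R.PiY ≃ₜ* R.PiY} {s t : ℤ} {ε δ : ℤˣ}, R.ActsOnCuspsBy a s ε → R.ActsOnCuspsBy b t δ →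
      R.ActsOnCuspsBy (a.trans b) (δ * s + t) (δ * ε)) ∧
    (∀ {a : R.PiY ≃ₜ* R.PiY} {s : ℤ} {ε : ℤˣ}, R.ActsOnCuspsBy a s ε →
      R.ActsOnCuspsBy a.symm (-((ε⁻¹ : ℤˣ) : ℤ) * s) ε⁻¹) :=
  ⟨R.actsOnCuspsBy_refl, fun ha hb => ha.trans hb, fun ha => ha.symm⟩

/-! ### §3 At the toy carrier `RigidData.Toy.toy l`: every automorphism acts by `(0, ±1)` and by nothing else -/

namespace Toy

/-- **INSTANCE at the TOY carrier** `RigidData.Toy.toy l` (labels `{⊥}` at `0`, `∅` elsewhere; a designed toy,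
not the cusps of a curve): EVERY bi-continuous automorphism `a` of `Π^tp_Y` acts on the labels by `(0, ε)` for
EVERY sign `ε` — the label `0` is the only inhabited one and `⊥ ↦ ⊥`. [cite: MochizukiEtTh2009, Prop 2.14(iii) p.50] -/
theorem actsOnCuspsBy_zero (l : ℕ) (a : (toy l).PiY ≃ₜ* (toy l).PiY) (ε : ℤˣ) :
    Literature.AnabelianGeometry.EtaleTheta.RigidData.ActsOnCuspsBy (toy l) a 0 ε := by
  intro n
  by_cases hn : n = 0
  · subst hn
    show (fun H : Subgroup (toy l).PiY => H.map a.toMulEquiv.toMonoidHom) '' {⊥} =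
      (if (ε : ℤ) * 0 + 0 = 0 then {⊥} else ∅)
    rw [mul_zero, add_zero, if_pos rfl, Set.image_singleton, Subgroup.map_bot]
  · have hε : (ε : ℤ) * n + 0 ≠ 0 := by
      rw [add_zero]
      exact mul_ne_zero (Units.ne_zero ε) hn
    show (fun H : Subgroup (toy l).PiY => H.map a.toMulEquiv.toMonoidHom) '' (if n = 0 then {⊥} else ∅) =
      (if (ε : ℤ) * n + 0 = 0 then {⊥} else ∅)
    rw [if_neg hn, if_neg hε, Set.image_empty]

/-- At the toy, `a` acts by `(s, ε)` IFF `s = 0`: the translation part is forced to vanish (the inhabited label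
`0` must go to an inhabited label), the sign is free. [cite: MochizukiEtTh2009, Prop 2.14(iii) p.50] -/
theorem actsOnCuspsBy_iff (l : ℕ) (a : (toy l).PiY ≃ₜ* (toy l).PiY) (s : ℤ) (ε : ℤˣ) :
    (toy l).ActsOnCuspsBy a s ε ↔ s = 0 := by
  refine ⟨fun h => ?_, fun hs => hs ▸ actsOnCuspsBy_zero l a ε⟩
  by_contra hs
  have h0 := h 0
  have hne : ((fun H : Subgroup (toy l).PiY => H.map a.toMulEquiv.toMonoidHom) '' (toy l).cuspY 0).Nonempty := by
    show ((fun H : Subgroup (toy l).PiY => H.map a.toMulEquiv.toMonoidHom) ''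
      (if (0 : ℤ) = 0 then {⊥} else ∅)).Nonempty
    rw [if_pos rfl, Set.image_singleton]
    exact Set.singleton_nonempty _
  rw [h0] at hne
  have : (toy l).cuspY ((ε : ℤ) * 0 + s) = ∅ := by
    show (if (ε : ℤ) * 0 + s = 0 then ({⊥} : Set (Subgroup (toy l).PiY)) else ∅) = ∅
    rw [mul_zero, zero_add, if_neg hs]
  rw [this] at hne
  exact Set.not_nonempty_empty hne

/-- **Census pair for F-0619 in one statement**: the predicate is INHABITED at every datum by the identity with
`(0, +1)` (instance form), while its universal closure is false (abc-iut-w5-d175's toy: no automorphism translates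
the labels by `1`). [cite: MochizukiEtTh2009, Prop 2.14(iii) p.50] -/
theorem actsOnCuspsBy_instance_and_closure_refuted :
    (∀ (N : ℕ+) (l : ℕ) (R : RigidData.{0} N l), R.ActsOnCuspsBy (ContinuousMulEquiv.refl R.PiY) 0 1) ∧
    ¬ ∀ (N : ℕ+) (l : ℕ) (R : RigidData.{0} N l) (a : R.PiY ≃ₜ* R.PiY) (s : ℤ) (ε : ℤˣ),
      R.ActsOnCuspsBy a s ε :=
  ⟨fun _ _ R => R.actsOnCuspsBy_refl, not_forall_actsOnCuspsBy⟩

end Toy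

end RigidData

end Literature.AnabelianGeometry.EtaleTheta
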